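import Summits.CriticalPhenomena.PercolationContinuityZ3.Theorems.Transplant.SkelSignDropAssembly
import Summits.CriticalPhenomena.PercolationContinuityZ3.Theorems.Transplant.PlanarSkeletonSignShift
import HarnessLib

/-!
# D″ node, the (Z″) ASSEMBLY TOP WITH STEP I′ DISCHARGED, CENTRED FORM (DPRIME-SCOPE §2 L7′, addenda M.3/M.7; DP1): the hypothesis of
# `PlanarSkeletonSign.samePDropOfSkeletonSign_of_stepI_run` (p249513) with the normalisation `Φ.φ t = 0` AVAILABLE to the instance — the form the
# D″ cell geometry `Skelφ.cellGeomSG G φ P t Λ` (root in base position) and the L7′ choice function will consume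

builds on p205010 (kernel theorem, internal audit signed; external expert review pending) — nothing in this file uses p205010.
Lane `prim-bschramm`, seat `prim-bschramm-p3` (gen 7; D″ design owner); helper file (`--supports stmt-CriticalPhenomena-4575`).
Proof: Hutchcroft off exponential growth (`samePDropOfSkeletonSign_of_subexponential_case'`); at `p_c` pass to the re-centred skeleton
`Φ.shift (Φ.φ t)` (`PlanarSkeletonSignShift`: same base vertices, Φ2 transported), run Step I′ THERE (`PlanarSkeletonSign.exists_stepI`), take the
instance's lists and per-density schemes, and conclude by the structure-free pointwise drop `Skelφ.exists_drop_of_inputs_run'` — `θ_t` does not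
see the skeleton, so nothing has to be transported back.
[cite: KozmaNitzan2024, §1 p. 2 (approach 1); §4 Theorem 6 (pp. 25–31), p. 15 (symmetries), p. 17 (Step I)] [cite: Hutchcroft2016, Thm. 1]
-/

noncomputable section

open MeasureTheory ProbabilityTheory
open scoped ENNReal Classical

namespace Summit.CriticalPhenomena.PercolationContinuityZ3.Theorems.Transplant

open Literature.Probability.Percolation Literature.Probability.LatticeModels SimpleGraph KNCells
open Literature.Barriers.CriticalPhenomena (HasExponentialGrowth countable_of_connected_of_locallyFinite)

namespace PlanarSkeletonSign

/-- **THE D″ v2 ASSEMBLY TOP WITH STEP I′ DISCHARGED, CENTRED**: as `samePDropOfSkeletonSign_of_stepI_run`, but the instance may assume the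
root in base position `Φ.φ t = 0`.  For every locally finite `G` NOT of exponential growth with a `PlanarSkeletonSign Φ`, every `t ∈ Φ.types`
WITH `Φ.φ t = 0`, every `0 < p < 1` with a.s. uniqueness, Φ2 (`hC`) and `θ_t(p) > 0`: the instance names `δI > 0`, `m₀`; receives Step-I′ data
`D, off, M₀, n₁` with the seven facts; returns admissible finite lists `Sz Sx Sy` and, at every `q ∈ [p/2, p]` where the Step-I′ family over
them holds with accuracy `δI` under Φ2, a run-restricted anchored-cells scheme rooted at `t` at density `q` with `KitAtRun`.  Then
`SamePDropOfSkeletonSign`. [cite: KozmaNitzan2024, §1 p. 2 (approach 1); §4 Theorem 6 (pp. 25–31), p. 15, p. 17] -/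
theorem samePDropOfSkeletonSign_of_stepI_run_centred
    (h : ∀ {V : Type} [DecidableEq V] [Countable V] (G : SimpleGraph V) [G.LocallyFinite] (Φ : PlanarSkeletonSign G),
      ¬ HasExponentialGrowth G → ∀ t ∈ Φ.types, Φ.φ t = 0 → ∀ p : unitInterval, 0 < (p : ℝ) → (p : ℝ) < 1 →
        (∀ᵐ ω ∂bondPercolation G p, numInfiniteClusters ω ≤ 1) → ∀ hC : Φ.CylSubcritical p, 0 < theta G t p →
          ∃ (δI : ℝ) (m₀ : ℕ), 0 < δI ∧
            ∀ (D : Skelφ.StepI.Data V) (off M₀ n₁ : ℕ), m₀ ≤ D.k → 1 ≤ D.k → D.R = Skelφ.fatRadius Φ.frame hC →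
              D.Λ = Skelφ.fatSeqOff Φ.frame hC off → D.k < M₀ → D.k < n₁ → (∀ ℓ, D.k ≤ D.Gb ℓ ∧ D.k ≤ D.Fb ℓ) →
              ∃ Sz Sx Sy : Finset ℕ, (∀ M ∈ Sz, M₀ ≤ M) ∧ (∀ ℓ ∈ Sx, n₁ ≤ ℓ) ∧ (∀ ℓ ∈ Sy, n₁ ≤ ℓ) ∧
                ∀ q : unitInterval, (p : ℝ) / 2 ≤ q → (q : ℝ) ≤ p →
                  (∀ i ∈ Skelφ.StepI.index Φ.types Sz Sx Sy,
                    1 - δI < (bondPercolation G q).real (Skelφ.StepI.event G Φ.φ D i)) →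
                  Φ.CylSubcritical q →
                    ∃ (A : Type) (S : KSchA V A) (FD : FaceData V A) (LD : LevelData V A) (ε' δ₂ : ℝ),
                      S.Γ.root = t ∧ S.p = q ∧
                      RunGeom G S.Γ ∧ AnchGeom S.Γ ∧ SepGeom₂ G S.Γ ∧ ExitGeom G S.Γ ∧ StepsGeom S.Γ FD ∧ LevelGeom G S.Γ FD LD ∧
                      S.δc ≤ 1 ∧ 0 ≤ ε' ∧ δ₂ ≤ 1 ∧ 4 * ((1 - δ₂) ^ S.Γ.K + ε') ≤ (1 / 2) ^ 32 ∧
                      KSchA.KitAtRun G S FD δ₂ ε') :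
    SamePDropOfSkeletonSign := by
  refine samePDropOfSkeletonSign_of_subexponential_case' fun {V} G _ Φ hg t ht hC => ?_
  haveI : Countable V := countable_of_connected_of_locallyFinite G (Φ.toPlanarSkeletonNeg.graph_connected t) t
  -- pass to the re-centred skeleton `Ψ := Φ.shift (φ t)` (same base vertices, Φ2 transported)
  have hCΨ : (Φ.shift (Φ.φ t)).CylSubcritical (criticalProbIOf G t) :=
    (Φ.shift_cylSubcritical_iff_skelφ (Φ.φ t) _).2 ((Φ.toPlanarSkeletonNeg.cylSubcritical_iff_skelφ _).1 hC)
  have htΨ : t ∈ (Φ.shift (Φ.φ t)).types := ht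
  refine theta_criticalProbIOf_eq_zero_of_drop_at G t fun hθ => ?_
  have hp0 : 0 < ((criticalProbIOf G t : unitInterval) : ℝ) := pos_of_theta_pos hθ
  have hp1 : ((criticalProbIOf G t : unitInterval) : ℝ) < 1 := Φ.criticalProb_lt_one t
  have hU := (Φ.shift (Φ.φ t)).numInfiniteClusters_le_one hg htΨ (criticalProbIOf G t)
  obtain ⟨δI, m₀, hδI, hB⟩ := h G (Φ.shift (Φ.φ t)) hg t htΨ (sub_self _) _ hp0 hp1 hU hCΨ hθ
  -- Step I′ on the centred skeleton at `p_c`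
  obtain ⟨D, off, M₀, n₁, hk₀, hk₁, hR, hΛ, hM₀, hn₁, hGF, hfam⟩ := (Φ.shift (Φ.φ t)).exists_stepI hg hCΨ hθ htΨ hδI m₀
  obtain ⟨Sz, Sx, Sy, hSz, hSx, hSy, hq⟩ := hB D off M₀ n₁ hk₀ hk₁ hR hΛ hM₀ hn₁ hGF
  -- the structure-free pointwise drop with (A) := the Step-I′ family of the centred skeleton
  exact Skelφ.exists_drop_of_inputs_run' (φ := (Φ.shift (Φ.φ t)).φ) (types := (Φ.shift (Φ.φ t)).types) t hp0
    (((Φ.shift (Φ.φ t)).toPlanarSkeletonNeg.cylSubcritical_iff_skelφ _).1 hCΨ)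
    (Skelφ.StepI.index (Φ.shift (Φ.φ t)).types Sz Sx Sy) (Skelφ.StepI.event G (Φ.shift (Φ.φ t)).φ D)
    (Skelφ.StepI.edges G (Φ.shift (Φ.φ t)).φ D) (fun _ => 1 - δI)
    (fun i _ => Skelφ.StepI.determinedBy_event G (Φ.shift (Φ.φ t)).φ D i) (hfam Sz Sx Sy hSz hSx hSy)
    fun q hq1 hq2 hcq hCq => hq q hq1 hq2 hcq (((Φ.shift (Φ.φ t)).toPlanarSkeletonNeg.cylSubcritical_iff_skelφ q).2 hCq)

end PlanarSkeletonSign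

end Summit.CriticalPhenomena.PercolationContinuityZ3.Theorems.Transplant

end
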